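import Summits.Schanuel.Schanuel.Theorems.ZilberEacWeightedPlaces
import HarnessLib

/-!
# Arbitrary base branches, LX (b): THE STEEPEST EDGE OF THE NEWTON POLYGON AT INFINITY — every
# monic irreducible plane curve of `x₁`-degree `≥ 2` has a place `x₀ = s^{-k}`, `x₁ = Φ(s)s^{-M}`,
# `k, M ≥ 1`, `Φ(0) ≠ 0`

HONEST FRAMING.  Cell `pub-schanuel` (Zilber's Exponential-Algebraic Closedness, case ladder;
host summit Schanuel), seat 2, gen 31.  `F ∈ ℂ[x₀][x₁]` monic of `x₁`-degree `n`, rows `f_j`;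
weights `(k, M)`, `k ≥ 1`, with `k·deg f_j ≤ M(n - j)` for all `j < n` (the line `ki + Mj = Mn`
supports the Newton polygon at infinity at the vertex `(0, n)`); the edge polynomial
`E(t) = Σ_{k deg f_j = M(n-j)} lc(f_j) t^j`.
* **`exists_place_of_edgeRoot`** — every root `θ` of `E` is `Φ(0)` for a place `x₀ = s^{-ek}`,
  `x₁ = Φ(s)s^{-eM}` of `F = 0` (file LX (a) applied to the weighted substitution, whose top row at
  level `Mn` is `E`);
* **`exists_place_of_steepestEdge`** — if the equality is attained at some `j < n` with `f_j ≠ 0`,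
  `E` has two nonzero coefficients, hence a NONZERO root: a place with `Φ(0) ≠ 0`;
* **`exists_place_atInfinity_of_monic`** — every monic IRREDUCIBLE `F` of `x₁`-degree `≥ 2` has a
  row of positive degree, so the weights `(n - j⋆, deg f_{j⋆})` at a row maximising
  `deg f_j/(n - j)` give a place with `k, M ≥ 1` and `Φ(0) ≠ 0`.
So the place hypothesis of file LIV is dischargeable for every monic irreducible base curve; only
the direction datum remains (file LXI).  [folklore (Newton–Puiseux at infinity), made concrete];
nothing here is specific to Schanuel's conjecture (neither used nor implied); Mantova–Masser's
question (PLMS 2024 §1 p. 5) and EC(3,2) stay OPEN.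
-/

noncomputable section

open Filter Topology Polynomial

set_option linter.dupNamespace false

namespace Summit.Schanuel.Schanuel.Theorems

/-! ## Part D. The steepest edge of the Newton polygon at infinity of a monic curve -/

/-- A complex polynomial with two distinct nonzero coefficients has a nonzero root. [folklore] -/
theorem exists_isRoot_ne_zero_of_coeff_ne_zero {E : ℂ[X]} {i j : ℕ} (hij : i ≠ j)
    (hi : E.coeff i ≠ 0) (hj : E.coeff j ≠ 0) : ∃ θ : ℂ, θ ≠ 0 ∧ E.IsRoot θ := by
  classical
  have hE0 : E ≠ 0 := fun h => hi (by rw [h, Polynomial.coeff_zero])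
  obtain ⟨E₁, hEE₁, hndvd⟩ := E.exists_eq_pow_rootMultiplicity_mul_and_not_dvd hE0 0
  rw [map_zero, sub_zero] at hEE₁ hndvd
  have hE₁0 : ¬ E₁.IsRoot 0 := by
    intro h
    exact hndvd (by simpa using (Polynomial.dvd_iff_isRoot (a := (0 : ℂ)) (p := E₁)).2 h)
  have hdeg : E₁.degree ≠ 0 := by
    intro hdeg
    have hC := Polynomial.eq_C_of_degree_eq_zero hdeg
    have hcoef : ∀ l, E.coeff l ≠ 0 → l = E.rootMultiplicity 0 := by
      intro l hl
      rw [hEE₁, hC, Polynomial.coeff_X_pow_mul', Polynomial.coeff_C] at hl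
      split_ifs at hl with h1 h2
      · omega
      · exact absurd rfl hl
      · exact absurd rfl hl
    exact hij ((hcoef i hi).trans (hcoef j hj).symm)
  obtain ⟨θ, hθ⟩ := IsAlgClosed.exists_root E₁ hdeg
  refine ⟨θ, ?_, ?_⟩
  · rintro rfl; exact hE₁0 hθ
  · rw [Polynomial.IsRoot, hEE₁, Polynomial.eval_mul, hθ.eq_zero, mul_zero]

/-- **A place from a root of the edge polynomial** (`F` monic of `x₁`-degree `n`, weights
`(k, M)`, `k ≥ 1`, with `k·deg f_j ≤ M(n - j)` for all `j < n`; `E(t) = Σ_{k deg f_j = M(n-j)}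
lc(f_j) t^j`): every root `θ` of `E` is `Φ(0)` for a place `x₀ = s^{-ek}`, `x₁ = Φ(s)s^{-eM}` of
`F = 0`. [folklore (Newton–Puiseux at infinity)] (new in this form) -/
theorem exists_place_of_edgeRoot (F : ℂ[X][X]) (hFm : F.Monic)
    (hbez : ∃ (A B : ℂ[X][X]) (r : ℂ[X]), r ≠ 0 ∧ A * F + B * derivative F = Polynomial.C r)
    {k M : ℕ} (hk : 1 ≤ k)
    (hmax : ∀ j, j < F.natDegree → (F.coeff j).natDegree * k ≤ M * (F.natDegree - j))
    {E : ℂ[X]} (hE : ∀ j, E.coeff j =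
      if (F.coeff j).natDegree * k = M * (F.natDegree - j) then (F.coeff j).leadingCoeff else 0)
    {θ : ℂ} (hEθ : E.IsRoot θ) :
    ∃ (e : ℕ) (Φ : ℂ → ℂ), 1 ≤ e ∧ AnalyticAt ℂ Φ 0 ∧ Φ 0 = θ ∧
      ∀ᶠ s in 𝓝[≠] (0 : ℂ),
        (F.map (Polynomial.evalRingHom (s ^ (e * k))⁻¹)).eval (Φ s * (s ^ (e * M))⁻¹) = 0 := by
  classical
  have hk0 : 0 < k := hk
  set n := F.natDegree with hn
  have hFn : F.coeff n = 1 := hFm.coeff_natDegree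
  set W : ℂ[X][X] := (F.map (Polynomial.expand ℂ k : ℂ[X] →ₐ[ℂ] ℂ[X]).toRingHom).comp
    (Polynomial.C (X ^ M : ℂ[X]) * X) with hW
  have hWc : ∀ j, W.coeff j = Polynomial.expand ℂ k (F.coeff j) * X ^ (M * j) :=
    coeff_weightedSubst F k M
  -- the rows of `W` have degree `≤ M n`
  have hN : ∀ j, (W.coeff j).natDegree ≤ M * n := by
    intro j
    rw [hWc]
    by_cases hj0 : F.coeff j = 0
    · rw [hj0, map_zero, zero_mul, Polynomial.natDegree_zero]; exact Nat.zero_le _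
    rcases Nat.lt_or_ge j n with hj | hj
    · calc (Polynomial.expand ℂ k (F.coeff j) * X ^ (M * j)).natDegree
            ≤ (Polynomial.expand ℂ k (F.coeff j)).natDegree + (X ^ (M * j) : ℂ[X]).natDegree :=
            Polynomial.natDegree_mul_le
        _ = (F.coeff j).natDegree * k + M * j := by
            rw [Polynomial.natDegree_expand, Polynomial.natDegree_X_pow]
        _ ≤ M * (n - j) + M * j := by have := hmax j hj; omega
        _ = M * n := by rw [← mul_add, Nat.sub_add_cancel hj.le]
    · rcases hj.lt_or_eq with hj' | hj'
      · exact absurd (Polynomial.coeff_eq_zero_of_natDegree_lt hj') hj0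
      · rw [← hj', hFn, map_one, one_mul, Polynomial.natDegree_X_pow]
  -- the top row of `W` is `E`
  have hT : ∀ j, E.coeff j = (W.coeff j).coeff (M * n) := by
    intro j
    rw [hE, hWc]
    by_cases hj0 : F.coeff j = 0
    · simp [hj0]
    rcases Nat.lt_or_ge j n with hj | hj
    · have hsub : M * n - M * j = M * (n - j) := by
        conv_lhs => rw [← Nat.sub_add_cancel hj.le, mul_add, Nat.add_sub_cancel]
      rw [Polynomial.coeff_mul_X_pow', if_pos (Nat.mul_le_mul_left _ hj.le), hsub,
        Polynomial.coeff_expand hk0]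
      by_cases heq : (F.coeff j).natDegree * k = M * (n - j)
      · have hdvd : k ∣ M * (n - j) := ⟨(F.coeff j).natDegree, by rw [← heq, mul_comm]⟩
        have hdiv : M * (n - j) / k = (F.coeff j).natDegree :=
          Nat.div_eq_of_eq_mul_left hk0 heq.symm
        rw [if_pos heq, if_pos hdvd, hdiv, Polynomial.leadingCoeff]
      · rw [if_neg heq]
        split_ifs with hdvd
        · obtain ⟨c, hc⟩ := hdvd
          rw [hc, Nat.mul_div_cancel_left _ hk0]
          refine (Polynomial.coeff_eq_zero_of_natDegree_lt ?_).symm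
          have hle := hmax j hj
          rw [hc] at hle heq
          by_contra hlt
          push Not at hlt
          have : (F.coeff j).natDegree = c := by
            refine le_antisymm ?_ hlt
            exact Nat.le_of_mul_le_mul_right (by rwa [mul_comm k c] at hle) hk0
          exact heq (by rw [this, mul_comm])
        · rfl
    · rcases hj.lt_or_eq with hj' | hj'
      · exact absurd (Polynomial.coeff_eq_zero_of_natDegree_lt hj') hj0
      · rw [← hj', hFn, map_one, one_mul, Polynomial.coeff_X_pow, Nat.sub_self, mul_zero,
          Polynomial.natDegree_one, zero_mul, if_pos rfl, if_pos rfl, Polynomial.leadingCoeff_one]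
  have hE0 : E ≠ 0 := by
    intro h
    have h1 := hT n
    rw [h, Polynomial.coeff_zero, hWc, hFn, map_one, one_mul, Polynomial.coeff_X_pow, if_pos rfl] at h1
    exact one_ne_zero h1.symm
  exact exists_place_of_weightedTopRow F hbez hk M W (fun s t => eval_weightedSubst F k M s t) (M * n)
    hN E hT hE0 hEθ

/-- **The steepest edge has a nonzero root**: with `hmax` as above and the equality
`k·deg f_j = M(n - j)` attained at some `j < n` with `f_j ≠ 0`, there is `θ ≠ 0` and a place
`x₀ = s^{-ek}`, `x₁ = Φ(s)s^{-eM}`, `Φ(0) = θ`, of `F = 0`. [folklore (Newton–Puiseux at infinity)]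
(new in this form) -/
theorem exists_place_of_steepestEdge (F : ℂ[X][X]) (hFm : F.Monic)
    (hbez : ∃ (A B : ℂ[X][X]) (r : ℂ[X]), r ≠ 0 ∧ A * F + B * derivative F = Polynomial.C r)
    {k M : ℕ} (hk : 1 ≤ k)
    (hmax : ∀ j, j < F.natDegree → (F.coeff j).natDegree * k ≤ M * (F.natDegree - j))
    (hatt : ∃ j, j < F.natDegree ∧ F.coeff j ≠ 0 ∧ (F.coeff j).natDegree * k = M * (F.natDegree - j)) :
    ∃ (θ : ℂ) (e : ℕ) (Φ : ℂ → ℂ), θ ≠ 0 ∧ 1 ≤ e ∧ AnalyticAt ℂ Φ 0 ∧ Φ 0 = θ ∧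
      ∀ᶠ s in 𝓝[≠] (0 : ℂ),
        (F.map (Polynomial.evalRingHom (s ^ (e * k))⁻¹)).eval (Φ s * (s ^ (e * M))⁻¹) = 0 := by
  classical
  set n := F.natDegree with hn
  set E : ℂ[X] := ∑ j ∈ Finset.range (n + 1),
    if (F.coeff j).natDegree * k = M * (n - j) then Polynomial.monomial j (F.coeff j).leadingCoeff else 0
    with hEdef
  have hE : ∀ j, E.coeff j =
      if (F.coeff j).natDegree * k = M * (n - j) then (F.coeff j).leadingCoeff else 0 := by
    intro j
    rw [hEdef, Polynomial.finsetSum_coeff]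
    have hterm : ∀ i ∈ Finset.range (n + 1),
        (if (F.coeff i).natDegree * k = M * (n - i) then Polynomial.monomial i (F.coeff i).leadingCoeff
          else (0 : ℂ[X])).coeff j =
        if i = j then (if (F.coeff j).natDegree * k = M * (n - j) then (F.coeff j).leadingCoeff else 0)
          else 0 := by
      intro i _
      by_cases hij : i = j
      · subst hij
        rw [if_pos rfl]
        split_ifs
        · rw [Polynomial.coeff_monomial, if_pos rfl]
        · rw [Polynomial.coeff_zero]
      · rw [if_neg hij]
        split_ifs
        · rw [Polynomial.coeff_monomial, if_neg hij]
        · rw [Polynomial.coeff_zero]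
    rw [Finset.sum_congr rfl hterm, Finset.sum_ite_eq' (Finset.range (n + 1)) j]
    by_cases hj : j ∈ Finset.range (n + 1)
    · rw [if_pos hj]
    · rw [if_neg hj]
      rw [Finset.mem_range, not_lt] at hj
      have h0 : F.coeff j = 0 := Polynomial.coeff_eq_zero_of_natDegree_lt (by omega)
      rw [h0, Polynomial.natDegree_zero, zero_mul, show n - j = 0 by omega, mul_zero, if_pos rfl,
        Polynomial.leadingCoeff_zero]
  obtain ⟨j, hj, hj0, hjeq⟩ := hatt
  have hEj : E.coeff j ≠ 0 := by
    rw [hE, if_pos hjeq]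
    exact Polynomial.leadingCoeff_ne_zero.2 hj0
  have hEn : E.coeff n ≠ 0 := by
    rw [hE, hFm.coeff_natDegree, Polynomial.natDegree_one, zero_mul, Nat.sub_self, mul_zero, if_pos rfl,
      Polynomial.leadingCoeff_one]
    exact one_ne_zero
  obtain ⟨θ, hθ0, hEθ⟩ := exists_isRoot_ne_zero_of_coeff_ne_zero hj.ne hEj hEn
  obtain ⟨e, Φ, he, hΦan, hΦ0, hplace⟩ := exists_place_of_edgeRoot F hFm hbez hk hmax hE hEθ
  exact ⟨θ, e, Φ, hθ0, he, hΦan, hΦ0, hplace⟩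

/-- **In a monic irreducible `F ∈ ℂ[x₀][x₁]` of `x₁`-degree `≥ 2` some row has positive degree**
(otherwise `F ∈ ℂ[x₁]` would have a root). [folklore] -/
theorem exists_coeff_natDegree_pos_of_irreducible (F : ℂ[X][X]) (hFm : F.Monic) (hFirr : Irreducible F)
    (hn : 2 ≤ F.natDegree) : ∃ j, j < F.natDegree ∧ 1 ≤ (F.coeff j).natDegree := by
  classical
  by_contra hall
  push Not at hall
  -- `F = map C f` with `f ∈ ℂ[X]` monic of degree `≥ 2`
  set f : ℂ[X] := ∑ j ∈ Finset.range (F.natDegree + 1), Polynomial.monomial j (((F.coeff j).coeff 0)) with hf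
  have hFf : F = Polynomial.map Polynomial.C f := by
    ext j : 1
    rw [Polynomial.coeff_map, hf, Polynomial.finsetSum_coeff]
    simp only [Polynomial.coeff_monomial, Finset.sum_ite_eq', Finset.mem_range]
    split_ifs with hj
    · rcases (Nat.lt_succ_iff.1 hj).lt_or_eq with hj' | hj'
      · exact Polynomial.eq_C_of_natDegree_eq_zero (by have := hall j hj'; omega)
      · rw [hj', hFm.coeff_natDegree]; simp
    · rw [map_zero]; exact Polynomial.coeff_eq_zero_of_natDegree_lt (by omega)
  have hfdeg : f.natDegree = F.natDegree := by
    have := congrArg Polynomial.natDegree hFf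
    rwa [Polynomial.natDegree_map_eq_of_injective (Polynomial.C_injective), eq_comm] at this
  obtain ⟨a, ha⟩ := IsAlgClosed.exists_root f (by
    rw [Polynomial.degree_eq_natDegree, hfdeg]
    · exact_mod_cast (by omega : F.natDegree ≠ 0)
    · intro h; rw [h, Polynomial.natDegree_zero] at hfdeg; omega)
  -- then `X - C (C a)` divides `F`
  have hdvd : (Polynomial.X - Polynomial.C (Polynomial.C a) : ℂ[X][X]) ∣ F := by
    rw [hFf, show (Polynomial.X - Polynomial.C (Polynomial.C a) : ℂ[X][X]) =
      (Polynomial.X - Polynomial.C a).map Polynomial.C by simp]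
    exact Polynomial.map_dvd _ (Polynomial.dvd_iff_isRoot.2 ha)
  obtain ⟨G, hG⟩ := hdvd
  rcases hFirr.isUnit_or_isUnit hG with hu | hu
  · have := Polynomial.natDegree_eq_zero_of_isUnit hu
    rw [Polynomial.natDegree_X_sub_C] at this
    exact one_ne_zero this
  · have hGdeg := Polynomial.natDegree_eq_zero_of_isUnit hu
    have := congrArg Polynomial.natDegree hG
    rw [Polynomial.natDegree_mul (Polynomial.X_sub_C_ne_zero _) (fun h => by
      rw [h, mul_zero] at hG; exact hFm.ne_zero hG), Polynomial.natDegree_X_sub_C, hGdeg] at this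
    omega

/-- **Every monic irreducible plane curve of `x₁`-degree `≥ 2` has a place at infinity in the
cell's chart**: `k, M ≥ 1`, `Φ` analytic at `0` with `Φ(0) ≠ 0`, and `F(s^{-k}, Φ(s)s^{-M}) = 0`
for all small `s ≠ 0` (the steepest edge of the Newton polygon at infinity: the weights
`(n - j⋆, deg f_{j⋆})` at a row `j⋆` maximising `deg f_j / (n - j)`). [folklore (Newton–Puiseux at
infinity)] (new in this form) -/
theorem exists_place_atInfinity_of_monic (F : ℂ[X][X]) (hFm : F.Monic) (hFirr : Irreducible F)
    (hn : 2 ≤ F.natDegree) :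
    ∃ (k M : ℕ) (Φ : ℂ → ℂ), 1 ≤ k ∧ 1 ≤ M ∧ AnalyticAt ℂ Φ 0 ∧ Φ 0 ≠ 0 ∧
      ∀ᶠ s in 𝓝[≠] (0 : ℂ),
        (F.map (Polynomial.evalRingHom (s ^ k)⁻¹)).eval (Φ s * (s ^ M)⁻¹) = 0 := by
  classical
  set n := F.natDegree with hn'
  obtain ⟨j₀, hj₀, hj₀deg⟩ := exists_coeff_natDegree_pos_of_irreducible F hFm hFirr hn
  -- a row maximising `deg f_j / (n - j)`
  obtain ⟨j, hjmem, hjmax⟩ := Finset.exists_max_image (Finset.range n)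
    (fun j => ((F.coeff j).natDegree : ℚ) / ((n : ℚ) - j)) ⟨j₀, Finset.mem_range.2 hj₀⟩
  rw [Finset.mem_range] at hjmem
  set k : ℕ := n - j with hk
  set M : ℕ := (F.coeff j).natDegree with hM
  have hk1 : 1 ≤ k := by omega
  have hkq : ((n : ℚ) - j) = (k : ℚ) := by rw [hk, Nat.cast_sub hjmem.le]
  -- `M ≥ 1`: the maximum is at least the positive value at `j₀`
  have hM1 : 1 ≤ M := by
    have h := hjmax j₀ (Finset.mem_range.2 hj₀)
    rw [hkq] at h
    have hpos : (0 : ℚ) < ((F.coeff j₀).natDegree : ℚ) / ((n : ℚ) - j₀) := by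
      apply div_pos
      · exact_mod_cast hj₀deg
      · rw [sub_pos]; exact_mod_cast hj₀
    have hMpos : (0 : ℚ) < (M : ℚ) / k := hpos.trans_le h
    by_contra hM0
    push Not at hM0
    have : M = 0 := by omega
    rw [this, Nat.cast_zero, zero_div] at hMpos
    exact lt_irrefl _ hMpos
  have hmax : ∀ i, i < n → (F.coeff i).natDegree * k ≤ M * (n - i) := by
    intro i hi
    have h := hjmax i (Finset.mem_range.2 hi)
    rw [hkq, show ((n : ℚ) - i) = ((n - i : ℕ) : ℚ) by rw [Nat.cast_sub hi.le],
      div_le_div_iff₀ (by exact_mod_cast (by omega : 0 < n - i)) (by exact_mod_cast hk1)] at h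
    exact_mod_cast h
  have hatt : ∃ i, i < n ∧ F.coeff i ≠ 0 ∧ (F.coeff i).natDegree * k = M * (n - i) := by
    refine ⟨j, hjmem, fun h => ?_, by rw [hM, hk, mul_comm]⟩
    rw [hM, h, Polynomial.natDegree_zero] at hM1
    exact Nat.not_succ_le_zero 0 hM1
  obtain ⟨θ, e, Φ, hθ0, he, hΦan, hΦ0, hplace⟩ :=
    exists_place_of_steepestEdge F hFm (exists_bezout_derivative hFirr (by omega)) hk1 hmax hatt
  refine ⟨e * k, e * M, Φ, Nat.mul_le_mul he hk1, Nat.mul_le_mul he hM1, hΦan, by rw [hΦ0]; exact hθ0,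
    hplace⟩

end Summit.Schanuel.Schanuel.Theorems

end
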